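import Summits.QuantumFields.BalabanUV.Beta.D1BFx.GramWeightColourLift

/-!
# `BalabanUV.Beta.D1BFx.PackedWardLiftOddDrop` — road «BF-x» for binder row D1, slot (K), brick «A1-PACKED-TORUS» of the owner's
# `A1-PACKED-SPEC.md` v0 (b2b-balaban-beta-d1-p2 gen 15): PART 2 of the kernel form of the CHECK Q-A1P-1 — **THE COLOUR LIFT DOES NOT ABSORB
# THE PARITY DEFECT `R`** (Q-A1P-1 (b): NO, located) — and brick **(B2) «ODD-DROP»**: the four tadpole slots ARE blind to colour-odd insertions
# (Q-A1P-1 (a)∕(c): YES)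

HONEST DEPENDENCY (cell records, verbatim): «continuum YM on T⁴ ⇐ BetaPertH ∧ nine spine estimates (0/9 proved); BetaPertH ⇐ (D1) ∧ (D4) ∧
CAP+tail; G-an2-4 gates asym, D1 and NE2/3/4.»  HONEST FRAMING (cell contract, verbatim): «discharging `BetaPertH` makes Bałaban's UV stability
UNCONDITIONAL — a real constructive-QFT result; it is NOT the continuum limit and NOT the Clay problem.»  THIS MODULE DISCHARGES NOTHING of (K),
of D1 or of the wall: it is [folklore] finite-dimensional matrix algebra (Mathlib's `Matrix.kroneckerMap` API) over ABSTRACT data and the tree's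
`ColourLift` (`cgen`, the Kronecker bookkeeping), `GramWeightColourLift` (`tgramMix`), `SliceTransferJetsMixed` (`mixedVar`) and
`MixedVarPackedHess` (`hessT`) BY NAME.  No definition, no `def … : Prop`, nothing cited, 0 sorry.  It instantiates NO table of the cell.
NOT D1, NOT BetaPertH, NOT continuum, NOT Clay.

ABSOLUTE RULE (cell charter, verbatim): «No internally-minted statement may enter as a cited fact. Every hypothesis is either kernel-proved in this
package or a verbatim quotation of a PUBLISHED theorem with page reference. The manuscript(s) under audit are NOT citable for their own disputed
steps — they are the thing under adjudication; programme-internal (2001/route/tribunal) claims are never citable.»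

WHERE THIS SITS.  PART 1 (`PackedWardParitySplit`) shows, from [P1]∕[P2] and the source conditions of `WardJetsFromNoether.packedWard₂`, that the
EVEN packed tuple misses the mixed WARD-L letter by `−R` and the ODD tuple misses the first-order letter shape by `+R`,
`R := oslot X₁ (𝕄ₜ *ᵥ rₛ)` — abstract hypotheses (E)∕(O) below.  The spec's §3 proposes to lift the packed second jets as `(c·c)⊗k_e + c⊗k_o`
(`c = ColourLift.cgen`) so that K-TA4G's TWO-SIDED letters hold for the lifted data.  §3 here: for ANY colour dressings the lifted one-sided mixed
letter SPLITS by colour factor, and at the spec's dressing it equals `(cgen + 1) ⊗ R` — zero IFF `R = 0`; the untwisted dressing `(c·c)⊗(k_e + k_o)`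
has the letter (`ColourLift.lift_rel_mix`) but not the symmetry.  §4 here: the «ODD-DROP» half of the proposal IS right — every one-loop slot
that a second jet enters is a tadpole `tr(leg · X)` (`hessT`, `mixedVar` affine; `tgramMix` affine with `1⊗`-sandwiches), and a colour-diagonal
leg has tadpole `tr c · (…)` against a `c⊗`-insertion — brick (B2), valid for whatever repaired route.
* §3 **`lifted_mixed_letter_split`** (any `c`, `c₁`, `c₂`); **`lifted_mixed_letter_eq_kronecker_R`** (`c₂ = c·c`, under (E)∕(O): `= (c₁ − c·c) ⊗ R`);
  `kronecker_right_cancel_iff`, `kronecker_eq_zero_iff_right`; `cgen_sub_cgen_sq`, `cgen_add_one_ne_zero`; **`lifted_mixed_letter_cgen_iff`**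
  (`↔ R = 0`); **`transpose_kronecker_add_iff`** ∕ `transpose_cgen_sq_kronecker_add_iff` (`((c·c)⊗(k_e + k_o))ᵀ = … ↔ k_o = 0`).
* §4 «ODD-DROP»: `hessT_add_right` (`hessT L V V′ (W + E) = hessT L V V′ W + ½·tr(L·E)`), `hessT_add_right_of_trace`, `mixedVar_add_right`,
  `trace_mul_eq_zero_of_symm_of_antisymm` (colourless), **`trace_one_kronecker_mul_kronecker`** (`tr((1⊗L)(c⊗X)) = tr c · tr(L·X)`, `= 0` at
  `tr c = 0`, `reindex` form), **`hessT_one_kronecker_add_kronecker`** (+ `cgen` instance), **`tgramMix_add₂`** (the Φ-jet is affine in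
  `(wₛₜ, bₛₜ)`), **`tgramMix_lift_add₂`** (its lifted increment `cᵀ⊗(eᵀB₀W₀) + c′⊗(W₀ᵀfW₀) + c⊗(W₀ᵀB₀e)`),
  `trace_one_kronecker_mul_tgramMix_increment` (Φ-side tadpole of the increment vanishes at `tr c = tr c′ = 0`).
Provenance: D1 formalisation swarm leaf seat `b2b-balaban-beta-d1-formalise-leaf-03` gen 20 (INTENT I-d1leaf03g20-1), 2026-08-22.
-/

noncomputable section

namespace Summit.QuantumFields.BalabanUV.Beta.D1BFx.PackedWardLiftOddDrop

open Matrix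
open scoped Kronecker
open Summit.QuantumFields.BalabanUV.Beta.D1BFx.SliceTransferJetsMixed (mixedVar)
open Summit.QuantumFields.BalabanUV.Beta.D1BFx.MixedVarPackedHess (hessT)
open Summit.QuantumFields.BalabanUV.Beta.D1BFx.GramWeightColourLift (tgramMix)
open Summit.QuantumFields.BalabanUV.Beta.D1BFx.ColourLift (cgen cgen_mul_cgen trace_cgen cgen_transpose kronecker_transpose' sq_transpose
  kronecker_neg neg_kronecker)

/-! ## §3 The lift does not absorb `R` -/

section Lift

variable {l α ν ρ : Type*} [Fintype l] [Fintype ν] [DecidableEq l]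

/-- [folklore] **THE LIFTED ONE-SIDED MIXED LETTER SPLITS BY COLOUR FACTOR.**  For ANY colour dressings `c₂` of the even parts and `c₁` of
the odd parts of the packed second jets (`𝕂 = c₂⊗k_e + c₁⊗k_o`, `𝕎 = c₂⊗w_e + c₁⊗w_o`; first jets `c⊗·`, zeroth `1⊗·`):
`𝕂(1⊗Ŵ₀) + (c⊗kₛ)(c⊗wₜ) + (c⊗kₜ)(c⊗wₛ) + (1⊗K₀)𝕎 = c₂⊗(k_eŴ₀ + K₀w_e) + (c·c)⊗(kₛwₜ + kₜwₛ) + c₁⊗(k_oŴ₀ + K₀w_o)`. -/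
theorem lifted_mixed_letter_split (c c₁ c₂ : Matrix l l ℝ) (K₀ kₛ kₜ k_e k_o : Matrix α ν ℝ) (W₀ wₛ wₜ w_e w_o : Matrix ν ρ ℝ) :
    (c₂ ⊗ₖ k_e + c₁ ⊗ₖ k_o) * ((1 : Matrix l l ℝ) ⊗ₖ W₀) + (c ⊗ₖ kₛ) * (c ⊗ₖ wₜ) + (c ⊗ₖ kₜ) * (c ⊗ₖ wₛ)
        + ((1 : Matrix l l ℝ) ⊗ₖ K₀) * (c₂ ⊗ₖ w_e + c₁ ⊗ₖ w_o)
      = c₂ ⊗ₖ (k_e * W₀ + K₀ * w_e) + (c * c) ⊗ₖ (kₛ * wₜ + kₜ * wₛ) + c₁ ⊗ₖ (k_o * W₀ + K₀ * w_o) := by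
  rw [Matrix.add_mul, Matrix.mul_add, ← Matrix.mul_kronecker_mul, ← Matrix.mul_kronecker_mul, ← Matrix.mul_kronecker_mul,
    ← Matrix.mul_kronecker_mul, ← Matrix.mul_kronecker_mul, ← Matrix.mul_kronecker_mul, Matrix.mul_one, Matrix.mul_one, Matrix.one_mul,
    Matrix.one_mul, Matrix.kronecker_add, Matrix.kronecker_add, Matrix.kronecker_add]
  abel

/-- [folklore] **AT `c₂ = c·c`, UNDER THE SPLIT LETTERS (E)∕(O), THE LIFTED LETTER IS `(c₁ − c·c) ⊗ R`.**  (E): `k_eŴ₀ + kₛwₜ + kₜwₛ + K₀w_e = −R`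
(`packedWard₂_even_eq` read out), (O): `k_oŴ₀ + K₀w_o = R` (`packedWard₂_odd_eq_of_hst` read out). -/
theorem lifted_mixed_letter_eq_kronecker_R (c c₁ : Matrix l l ℝ) (K₀ kₛ kₜ k_e k_o : Matrix α ν ℝ) (W₀ wₛ wₜ w_e w_o : Matrix ν ρ ℝ)
    (R : Matrix α ρ ℝ) (hE : k_e * W₀ + kₛ * wₜ + kₜ * wₛ + K₀ * w_e = -R) (hO : k_o * W₀ + K₀ * w_o = R) :
    ((c * c) ⊗ₖ k_e + c₁ ⊗ₖ k_o) * ((1 : Matrix l l ℝ) ⊗ₖ W₀) + (c ⊗ₖ kₛ) * (c ⊗ₖ wₜ) + (c ⊗ₖ kₜ) * (c ⊗ₖ wₛ)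
        + ((1 : Matrix l l ℝ) ⊗ₖ K₀) * ((c * c) ⊗ₖ w_e + c₁ ⊗ₖ w_o)
      = (c₁ - c * c) ⊗ₖ R := by
  rw [lifted_mixed_letter_split, hO, ← Matrix.kronecker_add,
    show k_e * W₀ + K₀ * w_e + (kₛ * wₜ + kₜ * wₛ) = -R by rw [← hE]; abel, kronecker_neg, sub_eq_add_neg, Matrix.add_kronecker,
    neg_kronecker]
  abel

omit [Fintype l] [Fintype ν] [DecidableEq l] in
/-- [folklore] A nonzero matrix has a nonzero entry. -/
theorem exists_apply_ne_zero_of_ne_zero {m n : Type*} {A : Matrix m n ℝ} (hA : A ≠ 0) : ∃ i j, A i j ≠ 0 := by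
  by_contra hcon
  exact hA (Matrix.ext fun i j => by by_contra h; exact hcon ⟨i, j, h⟩)

omit [Fintype l] [Fintype ν] [DecidableEq l] in
/-- [folklore] A NONZERO left Kronecker factor can be cancelled: `A ⊗ R = A ⊗ R′ ↔ R = R′`. -/
theorem kronecker_right_cancel_iff {m n p q : Type*} {A : Matrix m n ℝ} (hA : A ≠ 0) (R R' : Matrix p q ℝ) :
    A ⊗ₖ R = A ⊗ₖ R' ↔ R = R' := by
  refine ⟨fun h => ?_, fun h => by rw [h]⟩
  obtain ⟨i, j, hij⟩ := exists_apply_ne_zero_of_ne_zero hA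
  ext x y
  have := congrFun (congrFun h (i, x)) (j, y)
  rw [Matrix.kroneckerMap_apply, Matrix.kroneckerMap_apply] at this
  exact mul_left_cancel₀ hij this

omit [Fintype l] [Fintype ν] [DecidableEq l] in
/-- [folklore] A Kronecker product with a NONZERO left factor vanishes iff the right factor does. -/
theorem kronecker_eq_zero_iff_right {m n p q : Type*} {A : Matrix m n ℝ} (hA : A ≠ 0) (R : Matrix p q ℝ) : A ⊗ₖ R = 0 ↔ R = 0 := by
  rw [← kronecker_right_cancel_iff hA R 0, Matrix.kronecker_zero]

omit [Fintype l] [Fintype ν] [DecidableEq l] in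
/-- [folklore] `cgen − cgen·cgen = cgen + 1`. -/
theorem cgen_sub_cgen_sq : cgen - cgen * cgen = cgen + 1 := by
  rw [cgen_mul_cgen, sub_neg_eq_add]

omit [Fintype l] [Fintype ν] [DecidableEq l] in
/-- [folklore] `cgen + 1 ≠ 0` (its `(0,0)` entry is `1`). -/
theorem cgen_add_one_ne_zero : cgen + 1 ≠ 0 := by
  intro h
  have := congrFun (congrFun h 0) 0
  simp [cgen] at this

/-- [folklore] **Q-A1P-1 (b), KERNEL FORM: the spec's dressing `(cgen·cgen)⊗k_e + cgen⊗k_o` satisfies the lifted one-sided mixed Ward letter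
IFF «R-NULL» `R = 0`** (under the split letters (E)∕(O) which `packedWard₂`'s hypotheses give). -/
theorem lifted_mixed_letter_cgen_iff (K₀ kₛ kₜ k_e k_o : Matrix α ν ℝ) (W₀ wₛ wₜ w_e w_o : Matrix ν ρ ℝ) (R : Matrix α ρ ℝ)
    (hE : k_e * W₀ + kₛ * wₜ + kₜ * wₛ + K₀ * w_e = -R) (hO : k_o * W₀ + K₀ * w_o = R) :
    ((cgen * cgen) ⊗ₖ k_e + cgen ⊗ₖ k_o) * ((1 : Matrix (Fin 2) (Fin 2) ℝ) ⊗ₖ W₀) + (cgen ⊗ₖ kₛ) * (cgen ⊗ₖ wₜ)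
        + (cgen ⊗ₖ kₜ) * (cgen ⊗ₖ wₛ) + ((1 : Matrix (Fin 2) (Fin 2) ℝ) ⊗ₖ K₀) * ((cgen * cgen) ⊗ₖ w_e + cgen ⊗ₖ w_o) = 0
      ↔ R = 0 := by
  rw [lifted_mixed_letter_eq_kronecker_R cgen cgen K₀ kₛ kₜ k_e k_o W₀ wₛ wₜ w_e w_o R hE hO, cgen_sub_cgen_sq]
  exact kronecker_eq_zero_iff_right cgen_add_one_ne_zero R

omit [Fintype l] [Fintype ν] [DecidableEq l] in
/-- [folklore] **THE UNTWISTED DRESSING IS NOT SYMMETRIC**: for `k_e` symmetric, `k_o` antisymmetric and a colour factor `c′` with `c′ᵀ = c′`,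
`c′ ≠ 0`: `(c′⊗(k_e + k_o))ᵀ = c′⊗(k_e + k_o) ↔ k_o = 0` (its letter is the tree's `ColourLift.lift_rel_mix`; its transposed letter is not). -/
theorem transpose_kronecker_add_iff {c' : Matrix l l ℝ} (hc' : c'ᵀ = c') (hc0 : c' ≠ 0) {k_e k_o : Matrix ν ν ℝ} (he : k_eᵀ = k_e)
    (ho : k_oᵀ = -k_o) : (c' ⊗ₖ (k_e + k_o))ᵀ = c' ⊗ₖ (k_e + k_o) ↔ k_o = 0 := by
  rw [kronecker_transpose', hc', Matrix.transpose_add, he, ho, kronecker_right_cancel_iff hc0, add_right_inj, neg_eq_iff_add_eq_zero,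
    ← two_smul ℝ k_o, smul_eq_zero, or_iff_right (two_ne_zero' ℝ)]

omit [Fintype l] [Fintype ν] [DecidableEq l] in
/-- [folklore] The instance `c′ = cgen·cgen = −1`: `((cgen·cgen)⊗(k_e + k_o))ᵀ = (cgen·cgen)⊗(k_e + k_o) ↔ k_o = 0`. -/
theorem transpose_cgen_sq_kronecker_add_iff {k_e k_o : Matrix ν ν ℝ} (he : k_eᵀ = k_e) (ho : k_oᵀ = -k_o) :
    ((cgen * cgen) ⊗ₖ (k_e + k_o))ᵀ = (cgen * cgen) ⊗ₖ (k_e + k_o) ↔ k_o = 0 := by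
  refine transpose_kronecker_add_iff (sq_transpose cgen_transpose) ?_ he ho
  rw [cgen_mul_cgen]
  exact neg_ne_zero.mpr one_ne_zero

end Lift

/-! ## §4 «ODD-DROP»: the four tadpole slots are blind to colour-odd insertions -/

section OddDrop

variable {ι κ l : Type*} [Fintype ι] [Fintype κ] [Fintype l] [DecidableEq l]

/-- [folklore] **`hessT` IS AFFINE IN THE SECOND JET**: `hessT L V V′ (W + E) = hessT L V V′ W + ½·tr(L·E)` — the second jet sits in the tadpole slot only. -/
theorem hessT_add_right (L V V' W E : Matrix ι ι ℝ) : hessT L V V' (W + E) = hessT L V V' W + (1 / 2) * (L * E).trace := by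
  unfold hessT
  rw [Matrix.mul_add, Matrix.trace_add]
  ring

/-- [folklore] A second-jet insertion with zero tadpole against the leg is invisible to `hessT`. -/
theorem hessT_add_right_of_trace (L V V' W E : Matrix ι ι ℝ) (h : (L * E).trace = 0) : hessT L V V' (W + E) = hessT L V V' W := by
  rw [hessT_add_right, h, mul_zero, add_zero]

variable [DecidableEq ι]

/-- [folklore] **`mixedVar` IS AFFINE IN THE SECOND JET**: `mixedVar A₀ A₁ A₁′ (A₂ + E) = mixedVar A₀ A₁ A₁′ A₂ + tr(A₀⁻¹·E)`. -/
theorem mixedVar_add_right (A₀ A₁ A₁' A₂ E : Matrix ι ι ℝ) : mixedVar A₀ A₁ A₁' (A₂ + E) = mixedVar A₀ A₁ A₁' A₂ + (A₀⁻¹ * E).trace := by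
  unfold mixedVar
  rw [Matrix.mul_add, Matrix.trace_add]
  ring

omit [DecidableEq ι] in
/-- [folklore] COLOURLESS ODD-DROP: a symmetric leg has zero tadpole against an antisymmetric insertion, `tr(L·E) = 0`. -/
theorem trace_mul_eq_zero_of_symm_of_antisymm {L E : Matrix ι ι ℝ} (hL : Lᵀ = L) (hE : Eᵀ = -E) : (L * E).trace = 0 := by
  have h : (L * E).trace = -(L * E).trace := by
    conv_lhs => rw [← Matrix.trace_transpose, Matrix.transpose_mul, hL, hE, Matrix.neg_mul, Matrix.trace_neg, Matrix.trace_mul_comm]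
  linarith

omit [DecidableEq ι] in
/-- [folklore] **LIFTED ODD-DROP, THE ONE LEMMA**: a colour-diagonal leg against a colour-dressed insertion has tadpole
`tr((1⊗L)(c⊗X)) = tr c · tr(L·X)`. -/
theorem trace_one_kronecker_mul_kronecker (L X : Matrix ι ι ℝ) (c : Matrix l l ℝ) :
    (((1 : Matrix l l ℝ) ⊗ₖ L) * (c ⊗ₖ X)).trace = c.trace * (L * X).trace := by
  rw [← Matrix.mul_kronecker_mul, Matrix.one_mul, Matrix.trace_kronecker]

omit [DecidableEq ι] in
/-- [folklore] … hence ZERO for a traceless colour factor (`c = cgen`: `trace_cgen`). -/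
theorem trace_one_kronecker_mul_kronecker_eq_zero (L X : Matrix ι ι ℝ) {c : Matrix l l ℝ} (hc : c.trace = 0) :
    (((1 : Matrix l l ℝ) ⊗ₖ L) * (c ⊗ₖ X)).trace = 0 := by
  rw [trace_one_kronecker_mul_kronecker, hc, zero_mul]

omit [DecidableEq ι] in
/-- [folklore] The same through a simultaneous re-indexing (the `e₂`∕`e₃` placements of the lifted bordered jets). -/
theorem trace_reindex_one_kronecker_mul_kronecker (e : l × ι ≃ κ) (L X : Matrix ι ι ℝ) (c : Matrix l l ℝ) :
    (reindex e e ((1 : Matrix l l ℝ) ⊗ₖ L) * reindex e e (c ⊗ₖ X)).trace = c.trace * (L * X).trace := by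
  have htr : ∀ Y : Matrix (l × ι) (l × ι) ℝ, (Y.submatrix e.symm e.symm).trace = Y.trace := fun Y => by
    simp only [Matrix.trace, Matrix.diag, Matrix.submatrix_apply]
    exact e.symm.sum_comp (fun i => Y i i)
  rw [Matrix.reindex_apply, Matrix.reindex_apply, Matrix.submatrix_mul_equiv, htr, trace_one_kronecker_mul_kronecker]

omit [DecidableEq ι] in
/-- [folklore] **ODD-DROP IN `hessT`, LIFTED**: with a colour-diagonal leg `1⊗L`, a colour-odd (`tr c = 0`) addition `c⊗E` to the second jet
changes nothing: `hessT (1⊗L) V V′ (W + c⊗E) = hessT (1⊗L) V V′ W` (M-, N- and comb sides: legs `1⊗M⁻¹`-corner, `1⊗N⁻¹`, `1⊗(τŴ₀)⁻¹`). -/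
theorem hessT_one_kronecker_add_kronecker (L E : Matrix ι ι ℝ) (V V' W : Matrix (l × ι) (l × ι) ℝ) {c : Matrix l l ℝ} (hc : c.trace = 0) :
    hessT ((1 : Matrix l l ℝ) ⊗ₖ L) V V' (W + c ⊗ₖ E) = hessT ((1 : Matrix l l ℝ) ⊗ₖ L) V V' W :=
  hessT_add_right_of_trace _ _ _ _ _ (trace_one_kronecker_mul_kronecker_eq_zero L E hc)

omit [DecidableEq ι] in
/-- [folklore] The `cgen` instance. -/
theorem hessT_one_kronecker_add_cgen_kronecker (L E : Matrix ι ι ℝ) (V V' W : Matrix (Fin 2 × ι) (Fin 2 × ι) ℝ) :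
    hessT ((1 : Matrix (Fin 2) (Fin 2) ℝ) ⊗ₖ L) V V' (W + cgen ⊗ₖ E) = hessT ((1 : Matrix (Fin 2) (Fin 2) ℝ) ⊗ₖ L) V V' W :=
  hessT_one_kronecker_add_kronecker L E V V' W trace_cgen

end OddDrop

section PhiSide

variable {l ι κ : Type*} [Fintype l] [Fintype ι] [Fintype κ] [DecidableEq l]

omit [Fintype κ] in
/-- [folklore] **THE Φ-SIDE SLOT IS AFFINE IN THE SECOND JETS** (Q-A1P-1 (a)∕(c)): `tgramMix W₀ wₛ wₜ (wₛₜ + e) B₀ bₛ bₜ (bₛₜ + f)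
= tgramMix W₀ wₛ wₜ wₛₜ B₀ bₛ bₜ bₛₜ + (eᵀ·B₀·W₀ + W₀ᵀ·f·W₀ + W₀ᵀ·B₀·e)` — the second gauge jet and the second weight jet (itself affine in the
co-frame second jets `tₛₜ`, `Aₛₜ` when `bₛₜ = tgramMix T A`) enter through three sandwiches between ZEROTH-order data. -/
theorem tgramMix_add₂ (W₀ wₛ wₜ wₛₜ e : Matrix ι κ ℝ) (B₀ bₛ bₜ bₛₜ f : Matrix ι ι ℝ) :
    tgramMix W₀ wₛ wₜ (wₛₜ + e) B₀ bₛ bₜ (bₛₜ + f)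
      = tgramMix W₀ wₛ wₜ wₛₜ B₀ bₛ bₜ bₛₜ + (eᵀ * B₀ * W₀ + W₀ᵀ * f * W₀ + W₀ᵀ * B₀ * e) := by
  simp only [tgramMix, Matrix.transpose_add, Matrix.add_mul, Matrix.mul_add]
  abel

omit [Fintype κ] in
/-- [folklore] **THE LIFTED Φ-SIDE INCREMENT CARRIES ONE COLOUR FACTOR PER TERM**: at zeroth data `1⊗W₀`, `1⊗B₀` and colour-dressed odd
insertions `c⊗e`, `c′⊗f`, the increment of `tgramMix_add₂` is `cᵀ⊗(eᵀB₀W₀) + c′⊗(W₀ᵀfW₀) + c⊗(W₀ᵀB₀e)` — each a `1⊗`-sandwich of ONE colour factor,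
hence of zero tadpole against the colour-diagonal leg `1⊗Φ₀⁻¹` when `tr c = tr c′ = 0` (Q-A1P-1 (a): YES). -/
theorem tgramMix_lift_add₂ (c c' : Matrix l l ℝ) (W₀ wₛ wₜ wₛₜ : Matrix (l × ι) (l × κ) ℝ) (e : Matrix ι κ ℝ)
    (B₀' bₛ bₜ bₛₜ : Matrix (l × ι) (l × ι) ℝ) (W₀0 : Matrix ι κ ℝ) (B₀ f : Matrix ι ι ℝ)
    (hW : W₀ = (1 : Matrix l l ℝ) ⊗ₖ W₀0) (hB : B₀' = (1 : Matrix l l ℝ) ⊗ₖ B₀) :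
    tgramMix W₀ wₛ wₜ (wₛₜ + c ⊗ₖ e) B₀' bₛ bₜ (bₛₜ + c' ⊗ₖ f)
      = tgramMix W₀ wₛ wₜ wₛₜ B₀' bₛ bₜ bₛₜ
        + (cᵀ ⊗ₖ (eᵀ * B₀ * W₀0) + c' ⊗ₖ (W₀0ᵀ * f * W₀0) + c ⊗ₖ (W₀0ᵀ * B₀ * e)) := by
  rw [tgramMix_add₂, hW, hB, kronecker_transpose', kronecker_transpose', Matrix.transpose_one, ← Matrix.mul_kronecker_mul,
    ← Matrix.mul_kronecker_mul, ← Matrix.mul_kronecker_mul, ← Matrix.mul_kronecker_mul, ← Matrix.mul_kronecker_mul,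
    ← Matrix.mul_kronecker_mul, Matrix.mul_one, Matrix.mul_one, Matrix.one_mul, Matrix.mul_one, Matrix.one_mul, Matrix.one_mul]

/-- [folklore] **ODD-DROP ON THE Φ-SIDE**: the tadpole of the lifted Φ-increment against a colour-diagonal leg vanishes when `tr c = tr c′ = 0`
(`tr cᵀ = tr c`). -/
theorem trace_one_kronecker_mul_tgramMix_increment (L : Matrix κ κ ℝ) (c c' : Matrix l l ℝ) (hc : c.trace = 0) (hc' : c'.trace = 0)
    (Y₁ Y₂ Y₃ : Matrix κ κ ℝ) :
    (((1 : Matrix l l ℝ) ⊗ₖ L) * (cᵀ ⊗ₖ Y₁ + c' ⊗ₖ Y₂ + c ⊗ₖ Y₃)).trace = 0 := by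
  have hct : cᵀ.trace = 0 := by rw [Matrix.trace_transpose, hc]
  rw [Matrix.mul_add, Matrix.mul_add, Matrix.trace_add, Matrix.trace_add, trace_one_kronecker_mul_kronecker_eq_zero L Y₁ hct,
    trace_one_kronecker_mul_kronecker_eq_zero L Y₂ hc', trace_one_kronecker_mul_kronecker_eq_zero L Y₃ hc, add_zero, add_zero]

end PhiSide

end Summit.QuantumFields.BalabanUV.Beta.D1BFx.PackedWardLiftOddDrop

end
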